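import Summits.HodgeConjecture.HodgeConjecture.Theorems.WeilTypeLadderTargetTransfer
import Literature.AlgebraicGeometry.HodgeTheory.FermatHodgeConjectureProducts
import Mathlib.RingTheory.Polynomial.Cyclotomic.Expand
import Mathlib.RingTheory.Polynomial.Cyclotomic.Roots
import Mathlib.Analysis.SpecialFunctions.Complex.Circle
import HarnessLib

/-!
# WeilTypeLadder · R3 (`WeilClassesCMField`) for the QUARTIC CM subfields `ℚ(ζ₅) ⊂ ℚ(ζ₁₅)`, `ℚ(ζ₅) ⊂ ℚ(ζ₂₀)`, `ℚ(ζ₈) ⊂ ℚ(ζ₁₆)`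
# on the `ζ_m`-primitive parts of abelian varieties with an automorphism of order `15`, `20`, `16` — the rung's arithmetic
# side conditions DISCHARGED in the kernel (cyclotomic polynomials), the transfer over a Fermat PAIR from the named facts

b2b cell `hweil` (packet `run/shared/lean/b2b/hodge-weil/`, report `b2b-hweil-pv3-g43/CM-SUBFIELD-TRANSFER.md` §3–§4: the FIRST
R3 PLACEMENTS of the ladder for a CM field `K′` of degree `4` that is a PROPER subfield of the cyclotomic field acting).

Objects. `B` a complex abelian variety with `s : B ⟶ B` and `Φ_m(s) = 0` in `End B` (`m ∈ {15, 20, 16}`; the intended `B` are the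
`ζ_m`-primitive Pryms `ker⁰ Φ_m(σ_*) ⊂ J(C)` of the connected `ℤ/m`-covers `C → ℙ¹`, `y^m = ∏ (x − bᵢ)^{βᵢ}`, with `N = h + 2` branch
points, `dim B = φ(m)h/2 = 4h`). The quartic CM subfield `K′ = ℚ(ζ₅)` of `E = ℚ(ζ₁₅)` (resp. `ℚ(ζ₂₀)`) is `ℚ(s³)` (resp. `ℚ(s⁴)`),
and `K′ = ℚ(ζ₈) ⊂ ℚ(ζ₁₆)` is `ℚ(s²)`: the rung's `(A, φ, P, e, m′) := (B, s³, Φ₅, 4, h)` etc., its space of `K′`-Weil classes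
`weilClassesField B φ P (2h) = W_{K′} ⊗ ℂ ⊂ H^{2h}(B)` (Moonen–Zarhin; `[K′:ℚ]·(2h) = 2·dim B`).

What is PROVED here (kernel): (§1) for every ring `R` and `s ∈ R`: `Φ₁₅(s) = 0 ⟹ Φ₅(s³) = 0`, `Φ₂₀(s) = 0 ⟹ Φ₅(s⁴) = 0`,
`Φ₁₆(s) = 0 ⟹ Φ₈(s²) = 0` (`expand` of cyclotomic polynomials); the complex roots of `Φ_n`, `n > 2`, are non-real and `T^{n−1}`
carries each to its conjugate; hence ALL EIGHT arithmetic hypotheses of `WeilClassesCMField` hold at `P = Φ₅` / `Φ₈` on these `B` —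
so the `_of_weilClassesCMField` theorems below are honest specialisations of the rung (nothing carried). (§2–§4) the R3 body on these
loci over a Fermat PAIR `Xʰ_m ⊗ Xʰ_m` (`m ≤ 20`: Shioda), from the two refereed named facts `hodgeClasses_algebraic_fermatProduct₂`,
`fulton1998_map_mem_algebraicClasses` (the proof of `weilClassesCMField_fermatPairTransfer_of_facts` of the companion file
`Theorems/WeilTypeLadderFermatTransferCMSubfield`, instantiated); from the rung; and ON-PATH from `HodgeConjecture`.

What is NOT in the kernel (PROPOSITION CYC′ of the report, pen-and-paper): that every such Prym carries the datum `(T, a, b)` with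
`a^*(W_{K′} ⊗ ℂ) ⊆ Σ b_S^*(M_{K′} ⊗ ℂ)`, `M_{K′}` spanned by rational `(h,h)`-classes of `Xʰ_m ⊗ Xʰ_m` EXACTLY when `β` is `K′`-Weil
(THEOREM W′ of `b2b-hweil-pv3-g41/NORM-RESIDUE.md` §7). Census (report §3, N = 4, two implementations): the `K′`-Weil NON-`E`-Weil
families are `(15; 1,4,5,5)`, `(15; 1,2,4,8)` [`ℚ(ζ₅)`], `(20; 1,5,5,9)`, `(20; 1,9,15,15)`, `(20; 1,1,9,9)`, `(20; 1,3,7,9)` [`ℚ(ζ₅)`],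
`(16; 1,3,5,7)`, `(16; 1,1,7,7)` [`ℚ(ζ₈)`] — abelian EIGHTFOLDS whose `K′`-Weil classes in `H⁴` are NOT cup products of Hodge classes
of `H²` (the `E`-Weil lines `⋀²V_n` are not Hodge there).

HONEST LABEL: one-parameter sub-families (resp. CM points) of the `8`-dimensional Shimura varieties of `K′`-Weil type, never the general
member; 0 unconditional rungs above the floor; conditional on [Shioda 1979 Thm. 2] + [Fulton 1998 Cor. 19.2 (b)] (refereed) and on the
datum; Markman-free; the standing `weilClassesField = W_{K′} ⊗ ℂ` identification flag applies. No `sorry`, no new definition, no new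
named fact.
-/

noncomputable section

-- every declaration of this problem lives in `Summit.HodgeConjecture.HodgeConjecture.…` (summit = sub-problem)
set_option linter.dupNamespace false

open CategoryTheory MonoidalCategory
open Literature.AlgebraicGeometry Literature.AlgebraicGeometry.Motives
open Literature.AlgebraicGeometry.HodgeTheory
open Literature.AlgebraicTopology.SingularHomology

namespace Summit.HodgeConjecture.HodgeConjecture.WeilTypeLadder

/-! ### §1 Cyclotomic lemmas: the arithmetic hypotheses of R3 at `P = Φ₅`, `Φ₈` -/

section Cyclotomic

variable {R : Type*} [Ring R]

/-- `Φ₅(X³) = Φ₁₅(X)·Φ₅(X)`, so `Φ₁₅(s) = 0 ⟹ Φ₅(s³) = 0` in any ring. [folklore] -/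
theorem eval₂_cyclotomic_five_pow_three (s : R)
    (hs : Polynomial.eval₂ (Int.castRingHom R) s (Polynomial.cyclotomic 15 ℤ) = 0) :
    Polynomial.eval₂ (Int.castRingHom R) (s ^ 3) (Polynomial.cyclotomic 5 ℤ) = 0 := by
  rw [← algebraMap_int_eq, ← Polynomial.aeval_def] at hs ⊢
  rw [← Polynomial.expand_aeval, Polynomial.cyclotomic_expand_eq_cyclotomic_mul Nat.prime_three
    (by norm_num) ℤ, map_mul, show (5 * 3 : ℕ) = 15 from rfl, hs, zero_mul]

/-- `Φ₅(X⁴) = Φ₂₀(X)·Φ₁₀(X)·Φ₅(X)`, so `Φ₂₀(s) = 0 ⟹ Φ₅(s⁴) = 0` in any ring. [folklore] -/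
theorem eval₂_cyclotomic_five_pow_four (s : R)
    (hs : Polynomial.eval₂ (Int.castRingHom R) s (Polynomial.cyclotomic 20 ℤ) = 0) :
    Polynomial.eval₂ (Int.castRingHom R) (s ^ 4) (Polynomial.cyclotomic 5 ℤ) = 0 := by
  rw [← algebraMap_int_eq, ← Polynomial.aeval_def] at hs ⊢
  rw [show s ^ 4 = (s ^ 2) ^ 2 by rw [← pow_mul], ← Polynomial.expand_aeval, ← Polynomial.expand_aeval,
    Polynomial.cyclotomic_expand_eq_cyclotomic_mul Nat.prime_two (by norm_num) ℤ, map_mul,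
    Polynomial.cyclotomic_expand_eq_cyclotomic Nat.prime_two (by norm_num : 2 ∣ 5 * 2) ℤ, map_mul,
    show (5 * 2 * 2 : ℕ) = 20 from rfl, hs, zero_mul]

/-- `Φ₈(X²) = Φ₁₆(X)`, so `Φ₁₆(s) = 0 ⟹ Φ₈(s²) = 0` in any ring. [folklore] -/
theorem eval₂_cyclotomic_eight_pow_two (s : R)
    (hs : Polynomial.eval₂ (Int.castRingHom R) s (Polynomial.cyclotomic 16 ℤ) = 0) :
    Polynomial.eval₂ (Int.castRingHom R) (s ^ 2) (Polynomial.cyclotomic 8 ℤ) = 0 := by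
  rw [← algebraMap_int_eq, ← Polynomial.aeval_def] at hs ⊢
  rw [← Polynomial.expand_aeval,
    Polynomial.cyclotomic_expand_eq_cyclotomic Nat.prime_two (by norm_num : 2 ∣ 8) ℤ,
    show (8 * 2 : ℕ) = 16 from rfl, hs]

/-- A complex root of `Φ_n ∈ ℤ[T]` is a primitive `n`-th root of unity (`n ≠ 0`). [folklore] -/
theorem isPrimitiveRoot_of_eval₂_cyclotomic {n : ℕ} (hn : n ≠ 0) {ρ : ℂ}
    (hρ : Polynomial.eval₂ (Int.castRingHom ℂ) ρ (Polynomial.cyclotomic n ℤ) = 0) : IsPrimitiveRoot ρ n := by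
  haveI : NeZero (n : ℂ) := ⟨Nat.cast_ne_zero.mpr hn⟩
  have h1 : Polynomial.IsRoot (Polynomial.cyclotomic n ℂ) ρ := by
    rw [Polynomial.IsRoot, ← Polynomial.map_cyclotomic_int n ℂ, Polynomial.eval_map]
    exact hρ
  exact Polynomial.isRoot_cyclotomic_iff.mp h1

/-- The complex roots of `Φ_n`, `n > 2`, are NON-REAL (`ρ̄ = ρ⁻¹ ≠ ρ` since `ρ² ≠ 1`): the "no real root" hypothesis of
`WeilClassesCMField` for `P = Φ_n`. [folklore] -/
theorem conj_ne_self_of_eval₂_cyclotomic {n : ℕ} (hn : 2 < n) {ρ : ℂ}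
    (hρ : Polynomial.eval₂ (Int.castRingHom ℂ) ρ (Polynomial.cyclotomic n ℤ) = 0) :
    starRingEnd ℂ ρ ≠ ρ := by
  have hn0 : n ≠ 0 := by omega
  have hprim : IsPrimitiveRoot ρ n := isPrimitiveRoot_of_eval₂_cyclotomic hn0 hρ
  have hnorm : ‖ρ‖ = 1 := Complex.norm_eq_one_of_pow_eq_one hprim.pow_eq_one hn0
  intro hc
  have hinv : ρ⁻¹ = ρ := by rw [Complex.inv_eq_conj hnorm]; exact hc
  have hsq : ρ ^ 2 = 1 := by
    calc ρ ^ 2 = ρ * ρ := sq ρ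
      _ = ρ * ρ⁻¹ := by rw [hinv]
      _ = 1 := mul_inv_cancel₀ (hprim.ne_zero hn0)
  exact hprim.pow_ne_one_of_pos_of_lt (by norm_num) hn hsq

/-- `Q = T^{n−1} ∈ ℚ[T]` carries every complex root of `Φ_n` (`n > 2`) to its complex conjugate (`ρ^{n−1} = ρ⁻¹ = ρ̄`): the
"CM involution is a polynomial" hypothesis of `WeilClassesCMField` for `P = Φ_n`. [folklore] -/
theorem exists_conjPolynomial_of_cyclotomic {n : ℕ} (hn : 2 < n) :
    ∃ Q : Polynomial ℚ, ∀ ρ : ℂ, Polynomial.eval₂ (Int.castRingHom ℂ) ρ (Polynomial.cyclotomic n ℤ) = 0 →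
      Polynomial.eval₂ (algebraMap ℚ ℂ) ρ Q = starRingEnd ℂ ρ := by
  refine ⟨Polynomial.X ^ (n - 1), fun ρ hρ => ?_⟩
  have hn0 : n ≠ 0 := by omega
  have hprim : IsPrimitiveRoot ρ n := isPrimitiveRoot_of_eval₂_cyclotomic hn0 hρ
  have hnorm : ‖ρ‖ = 1 := Complex.norm_eq_one_of_pow_eq_one hprim.pow_eq_one hn0
  rw [Polynomial.eval₂_X_pow, ← Complex.inv_eq_conj hnorm]
  have : ρ ^ (n - 1) * ρ = 1 := by
    rw [← pow_succ, Nat.sub_add_cancel (by omega)]; exact hprim.pow_eq_one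
  exact eq_inv_of_mul_eq_one_left this

/-- `Φ₅ ∈ ℤ[T]` is monic of degree `4` and irreducible over `ℚ`. [folklore] -/
theorem cyclotomic_five_monic_natDegree_irreducible :
    (Polynomial.cyclotomic 5 ℤ).Monic ∧ (Polynomial.cyclotomic 5 ℤ).natDegree = 4 ∧
      Irreducible ((Polynomial.cyclotomic 5 ℤ).map (Int.castRingHom ℚ)) := by
  refine ⟨Polynomial.cyclotomic.monic 5 ℤ, ?_, ?_⟩
  · rw [Polynomial.natDegree_cyclotomic]; decide
  · rw [Polynomial.map_cyclotomic_int]; exact Polynomial.cyclotomic.irreducible_rat (by norm_num)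

/-- `Φ₈ ∈ ℤ[T]` is monic of degree `4` and irreducible over `ℚ`. [folklore] -/
theorem cyclotomic_eight_monic_natDegree_irreducible :
    (Polynomial.cyclotomic 8 ℤ).Monic ∧ (Polynomial.cyclotomic 8 ℤ).natDegree = 4 ∧
      Irreducible ((Polynomial.cyclotomic 8 ℤ).map (Int.castRingHom ℚ)) := by
  refine ⟨Polynomial.cyclotomic.monic 8 ℤ, ?_, ?_⟩
  · rw [Polynomial.natDegree_cyclotomic]; decide
  · rw [Polynomial.map_cyclotomic_int]; exact Polynomial.cyclotomic.irreducible_rat (by norm_num)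

/-- In `End B`, the composite `s ≫ s ≫ s` is the cube of `s`. -/
theorem end_of_comp_three {B : Motives.AbelianVariety ℂ} (s : B ⟶ B) :
    CategoryTheory.End.of (s ≫ s ≫ s) = CategoryTheory.End.of s ^ 3 := by
  rw [pow_succ, pow_two, CategoryTheory.End.mul_def, CategoryTheory.End.mul_def]

/-- In `End B`, the composite `s ≫ s ≫ s ≫ s` is the fourth power of `s`. -/
theorem end_of_comp_four {B : Motives.AbelianVariety ℂ} (s : B ⟶ B) :
    CategoryTheory.End.of (s ≫ s ≫ s ≫ s) = CategoryTheory.End.of s ^ 4 := by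
  rw [pow_succ, pow_succ, pow_two, CategoryTheory.End.mul_def, CategoryTheory.End.mul_def,
    CategoryTheory.End.mul_def]

/-- In `End B`, the composite `s ≫ s` is the square of `s`. -/
theorem end_of_comp_two {B : Motives.AbelianVariety ℂ} (s : B ⟶ B) :
    CategoryTheory.End.of (s ≫ s) = CategoryTheory.End.of s ^ 2 := by
  rw [pow_two, CategoryTheory.End.mul_def]

end Cyclotomic

/-! ### §2 `E = ℚ(ζ₁₅)`, `K′ = ℚ(ζ₅) = ℚ(s³)`: the `ζ₁₅`-primitive loci over the Fermat pair `Xʰ₁₅ ⊗ Xʰ₁₅` -/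

section Fifteen

/-- **R3 for `K′ = ℚ(ζ₅) ⊂ ℚ(ζ₁₅)` on the Fermat-pair-dominated `ζ₁₅`-locus, from the two named facts.** For an abelian variety
`B` with `s : B ⟶ B`, `Φ₁₅(s) = 0`, `dim B = 4h`, and a datum (`X₁, X₂` smooth projective Fermat varieties `Xʰ₁₅`, `T` smooth
projective of dimension `dim B`, `a : T ⟶ B` surjective, `b : ι → (T ⟶ X₁ ⊗ X₂)`), every class of
`weilClassesField B (s³) Φ₅ (2h) = W_{ℚ(ζ₅)} ⊗ ℂ` whose pull-back `a^* c` lies in `⨆ᵢ (bᵢ)^*(span of the rational (h,h)-classes of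
X₁ ⊗ X₂)` and which is rational of type `(h,h)` is algebraic. PROPOSITION CYC′ (report §2) supplies the datum for the
`ζ₁₅`-primitive Prym of every `ℚ(ζ₅)`-Weil `ℤ/15`-cover of `ℙ¹` with `h + 2` branch points; at `h = 2` (EIGHTFOLDS, classes in `H⁴`)
the non-`E`-Weil families are `β = (1,4,5,5)` (moving) and `(1,2,4,8)` (CM point).
[cite: Shioda1979PJA, §2 Thm. 2 (p. 112) with the list after Thm. 1] [cite: Fulton1998, §19.2 Cor. 19.2 (b)]
[cite: MoonenZarhin1998WeilClasses, §1] -/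
theorem weilClassesCMField_cyclicPrymFifteen_zetaFive_of_facts
    (hF₂ : hodgeClasses_algebraic_fermatProduct₂) (hP : fulton1998_map_mem_algebraicClasses) :
    ∀ (B : Motives.AbelianVariety ℂ) (s : B ⟶ B) (h : ℕ),
      Polynomial.eval₂ (Int.castRingHom (CategoryTheory.End B)) (s : CategoryTheory.End B)
        (Polynomial.cyclotomic 15 ℤ) = 0 → B.dim = 4 * h →
    ∀ (X₁ X₂ T : Motives.SchemeOver ℂ),
      IsFermatVariety h 15 X₁ → IsSmoothProjective h X₁ → IsFermatVariety h 15 X₂ → IsSmoothProjective h X₂ →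
      IsSmoothProjective B.dim T →
    ∀ (a : T ⟶ B.X), AlgebraicGeometry.Surjective a.left → ∀ (ι : Type) (b : ι → (T ⟶ X₁ ⊗ X₂)),
      ∀ c ∈ weilClassesField B (s ≫ s ≫ s) (Polynomial.cyclotomic 5 ℤ) (2 * h),
        complexBetti.map a (2 * h) c ∈ (⨆ i, (Submodule.span ℂ
            {x : complexBetti (X₁ ⊗ X₂) (2 * h) |
              IsRationalClass x ∧ IsOfHodgeType (h + h) (X₁ ⊗ X₂) (2 * h) h h x}).map
              (complexBetti.map (b i) (2 * h)).hom) →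
        IsRationalClass c → IsOfHodgeType B.dim B.X (2 * h) h h c → c ∈ algebraicClasses B.X h := by
  intro B s h _ _ X₁ X₂ T hF₁' hX₁ hF₂' hX₂ hT a ha ι b c _ hc _ _
  exact abelianVariety_mem_algebraicClasses_of_targetTransferFamily hP B (hX₁.tensor_holds hX₂)
    (span_rational_hodge_le_algebraicClasses_fermatProduct₂ hF₂ (Or.inr ⟨by norm_num, by norm_num⟩) hF₁' hX₁ hF₂' hX₂ h)
    hT a b hc

/-- **The same body from the rung R3 itself** — an HONEST SPECIALISATION: every arithmetic hypothesis of `WeilClassesCMField`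
at `(A, φ, P, e, m) := (B, s³, Φ₅, 4, h)` is DISCHARGED here (`Φ₅` monic irreducible of degree `4 > 2`; `Φ₅(s³) = 0` from
`Φ₁₅(s) = 0`; `4·(2h) = 2·dim B`; roots non-real; `Q = T⁴`); the datum is not used. -/
theorem weilClassesCMField_cyclicPrymFifteen_zetaFive_of_weilClassesCMField (hR : WeilClassesCMField) :
    ∀ (B : Motives.AbelianVariety ℂ) (s : B ⟶ B) (h : ℕ),
      Polynomial.eval₂ (Int.castRingHom (CategoryTheory.End B)) (s : CategoryTheory.End B)
        (Polynomial.cyclotomic 15 ℤ) = 0 → B.dim = 4 * h →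
    ∀ (X₁ X₂ T : Motives.SchemeOver ℂ),
      IsFermatVariety h 15 X₁ → IsSmoothProjective h X₁ → IsFermatVariety h 15 X₂ → IsSmoothProjective h X₂ →
      IsSmoothProjective B.dim T →
    ∀ (a : T ⟶ B.X), AlgebraicGeometry.Surjective a.left → ∀ (ι : Type) (b : ι → (T ⟶ X₁ ⊗ X₂)),
      ∀ c ∈ weilClassesField B (s ≫ s ≫ s) (Polynomial.cyclotomic 5 ℤ) (2 * h),
        complexBetti.map a (2 * h) c ∈ (⨆ i, (Submodule.span ℂ
            {x : complexBetti (X₁ ⊗ X₂) (2 * h) |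
              IsRationalClass x ∧ IsOfHodgeType (h + h) (X₁ ⊗ X₂) (2 * h) h h x}).map
              (complexBetti.map (b i) (2 * h)).hom) →
        IsRationalClass c → IsOfHodgeType B.dim B.X (2 * h) h h c → c ∈ algebraicClasses B.X h := by
  intro B s h hs hdim _ _ _ _ _ _ _ _ _ _ _ _ c hcW _ hc hmm
  obtain ⟨hmon, hdeg, hirr⟩ := cyclotomic_five_monic_natDegree_irreducible
  have hφ : Polynomial.eval₂ (Int.castRingHom (CategoryTheory.End B))
      ((s ≫ s ≫ s : B ⟶ B) : CategoryTheory.End B) (Polynomial.cyclotomic 5 ℤ) = 0 := by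
    have h3 := eval₂_cyclotomic_five_pow_three (CategoryTheory.End.of s) hs
    rwa [← end_of_comp_three] at h3
  exact hR B (s ≫ s ≫ s) (Polynomial.cyclotomic 5 ℤ) 4 h hmon hdeg (by norm_num) hirr hφ (by omega)
    (fun ρ hρ => conj_ne_self_of_eval₂_cyclotomic (by norm_num) hρ)
    (exists_conjPolynomial_of_cyclotomic (by norm_num)) c hcW hc hmm

/-- **On-path lemma**: `HodgeConjecture → WeilClassesCMField →` R3 for `ℚ(ζ₅) ⊂ ℚ(ζ₁₅)` on the `ζ₁₅`-locus. -/
theorem weilClassesCMField_cyclicPrymFifteen_zetaFive_of_hodgeConjecture (hH : _root_.HodgeConjecture) :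
    ∀ (B : Motives.AbelianVariety ℂ) (s : B ⟶ B) (h : ℕ),
      Polynomial.eval₂ (Int.castRingHom (CategoryTheory.End B)) (s : CategoryTheory.End B)
        (Polynomial.cyclotomic 15 ℤ) = 0 → B.dim = 4 * h →
    ∀ (X₁ X₂ T : Motives.SchemeOver ℂ),
      IsFermatVariety h 15 X₁ → IsSmoothProjective h X₁ → IsFermatVariety h 15 X₂ → IsSmoothProjective h X₂ →
      IsSmoothProjective B.dim T →
    ∀ (a : T ⟶ B.X), AlgebraicGeometry.Surjective a.left → ∀ (ι : Type) (b : ι → (T ⟶ X₁ ⊗ X₂)),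
      ∀ c ∈ weilClassesField B (s ≫ s ≫ s) (Polynomial.cyclotomic 5 ℤ) (2 * h),
        complexBetti.map a (2 * h) c ∈ (⨆ i, (Submodule.span ℂ
            {x : complexBetti (X₁ ⊗ X₂) (2 * h) |
              IsRationalClass x ∧ IsOfHodgeType (h + h) (X₁ ⊗ X₂) (2 * h) h h x}).map
              (complexBetti.map (b i) (2 * h)).hom) →
        IsRationalClass c → IsOfHodgeType B.dim B.X (2 * h) h h c → c ∈ algebraicClasses B.X h :=
  weilClassesCMField_cyclicPrymFifteen_zetaFive_of_weilClassesCMField (weilClassesCMField_of_hodgeConjecture hH)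

end Fifteen

/-! ### §3 `E = ℚ(ζ₂₀)`, `K′ = ℚ(ζ₅) = ℚ(s⁴)`: the `ζ₂₀`-primitive loci over `Xʰ₂₀ ⊗ Xʰ₂₀` -/

section Twenty

/-- **R3 for `K′ = ℚ(ζ₅) ⊂ ℚ(ζ₂₀)` on the Fermat-pair-dominated `ζ₂₀`-locus, from the two named facts** (`B` with `s`,
`Φ₂₀(s) = 0`, `dim B = 4h`; datum over `Xʰ₂₀ ⊗ Xʰ₂₀`; classes of `weilClassesField B (s⁴) Φ₅ (2h)`). At `h = 2` the non-`E`-Weil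
`ℚ(ζ₅)`-Weil families are `β = (1,5,5,9)`, `(1,9,15,15)` (moving) and `(1,1,9,9)`, `(1,3,7,9)` (CM points) (report §3).
[cite: Shioda1979PJA, §2 Thm. 2 (p. 112) with the list after Thm. 1] [cite: Fulton1998, §19.2 Cor. 19.2 (b)]
[cite: MoonenZarhin1998WeilClasses, §1] -/
theorem weilClassesCMField_cyclicPrymTwenty_zetaFive_of_facts
    (hF₂ : hodgeClasses_algebraic_fermatProduct₂) (hP : fulton1998_map_mem_algebraicClasses) :
    ∀ (B : Motives.AbelianVariety ℂ) (s : B ⟶ B) (h : ℕ),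
      Polynomial.eval₂ (Int.castRingHom (CategoryTheory.End B)) (s : CategoryTheory.End B)
        (Polynomial.cyclotomic 20 ℤ) = 0 → B.dim = 4 * h →
    ∀ (X₁ X₂ T : Motives.SchemeOver ℂ),
      IsFermatVariety h 20 X₁ → IsSmoothProjective h X₁ → IsFermatVariety h 20 X₂ → IsSmoothProjective h X₂ →
      IsSmoothProjective B.dim T →
    ∀ (a : T ⟶ B.X), AlgebraicGeometry.Surjective a.left → ∀ (ι : Type) (b : ι → (T ⟶ X₁ ⊗ X₂)),
      ∀ c ∈ weilClassesField B (s ≫ s ≫ s ≫ s) (Polynomial.cyclotomic 5 ℤ) (2 * h),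
        complexBetti.map a (2 * h) c ∈ (⨆ i, (Submodule.span ℂ
            {x : complexBetti (X₁ ⊗ X₂) (2 * h) |
              IsRationalClass x ∧ IsOfHodgeType (h + h) (X₁ ⊗ X₂) (2 * h) h h x}).map
              (complexBetti.map (b i) (2 * h)).hom) →
        IsRationalClass c → IsOfHodgeType B.dim B.X (2 * h) h h c → c ∈ algebraicClasses B.X h := by
  intro B s h _ _ X₁ X₂ T hF₁' hX₁ hF₂' hX₂ hT a ha ι b c _ hc _ _
  exact abelianVariety_mem_algebraicClasses_of_targetTransferFamily hP B (hX₁.tensor_holds hX₂)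
    (span_rational_hodge_le_algebraicClasses_fermatProduct₂ hF₂ (Or.inr ⟨by norm_num, by norm_num⟩) hF₁' hX₁ hF₂' hX₂ h)
    hT a b hc

/-- **The same body from the rung R3 itself** (HONEST SPECIALISATION at `(A, φ, P, e, m) := (B, s⁴, Φ₅, 4, h)`: every
arithmetic hypothesis discharged; `Φ₅(s⁴) = 0` from `Φ₂₀(s) = 0`). -/
theorem weilClassesCMField_cyclicPrymTwenty_zetaFive_of_weilClassesCMField (hR : WeilClassesCMField) :
    ∀ (B : Motives.AbelianVariety ℂ) (s : B ⟶ B) (h : ℕ),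
      Polynomial.eval₂ (Int.castRingHom (CategoryTheory.End B)) (s : CategoryTheory.End B)
        (Polynomial.cyclotomic 20 ℤ) = 0 → B.dim = 4 * h →
    ∀ (X₁ X₂ T : Motives.SchemeOver ℂ),
      IsFermatVariety h 20 X₁ → IsSmoothProjective h X₁ → IsFermatVariety h 20 X₂ → IsSmoothProjective h X₂ →
      IsSmoothProjective B.dim T →
    ∀ (a : T ⟶ B.X), AlgebraicGeometry.Surjective a.left → ∀ (ι : Type) (b : ι → (T ⟶ X₁ ⊗ X₂)),
      ∀ c ∈ weilClassesField B (s ≫ s ≫ s ≫ s) (Polynomial.cyclotomic 5 ℤ) (2 * h),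
        complexBetti.map a (2 * h) c ∈ (⨆ i, (Submodule.span ℂ
            {x : complexBetti (X₁ ⊗ X₂) (2 * h) |
              IsRationalClass x ∧ IsOfHodgeType (h + h) (X₁ ⊗ X₂) (2 * h) h h x}).map
              (complexBetti.map (b i) (2 * h)).hom) →
        IsRationalClass c → IsOfHodgeType B.dim B.X (2 * h) h h c → c ∈ algebraicClasses B.X h := by
  intro B s h hs hdim _ _ _ _ _ _ _ _ _ _ _ _ c hcW _ hc hmm
  obtain ⟨hmon, hdeg, hirr⟩ := cyclotomic_five_monic_natDegree_irreducible
  have hφ : Polynomial.eval₂ (Int.castRingHom (CategoryTheory.End B))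
      ((s ≫ s ≫ s ≫ s : B ⟶ B) : CategoryTheory.End B) (Polynomial.cyclotomic 5 ℤ) = 0 := by
    have h4 := eval₂_cyclotomic_five_pow_four (CategoryTheory.End.of s) hs
    rwa [← end_of_comp_four] at h4
  exact hR B (s ≫ s ≫ s ≫ s) (Polynomial.cyclotomic 5 ℤ) 4 h hmon hdeg (by norm_num) hirr hφ (by omega)
    (fun ρ hρ => conj_ne_self_of_eval₂_cyclotomic (by norm_num) hρ)
    (exists_conjPolynomial_of_cyclotomic (by norm_num)) c hcW hc hmm

/-- **On-path lemma**: `HodgeConjecture → WeilClassesCMField →` R3 for `ℚ(ζ₅) ⊂ ℚ(ζ₂₀)` on the `ζ₂₀`-locus. -/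
theorem weilClassesCMField_cyclicPrymTwenty_zetaFive_of_hodgeConjecture (hH : _root_.HodgeConjecture) :
    ∀ (B : Motives.AbelianVariety ℂ) (s : B ⟶ B) (h : ℕ),
      Polynomial.eval₂ (Int.castRingHom (CategoryTheory.End B)) (s : CategoryTheory.End B)
        (Polynomial.cyclotomic 20 ℤ) = 0 → B.dim = 4 * h →
    ∀ (X₁ X₂ T : Motives.SchemeOver ℂ),
      IsFermatVariety h 20 X₁ → IsSmoothProjective h X₁ → IsFermatVariety h 20 X₂ → IsSmoothProjective h X₂ →
      IsSmoothProjective B.dim T →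
    ∀ (a : T ⟶ B.X), AlgebraicGeometry.Surjective a.left → ∀ (ι : Type) (b : ι → (T ⟶ X₁ ⊗ X₂)),
      ∀ c ∈ weilClassesField B (s ≫ s ≫ s ≫ s) (Polynomial.cyclotomic 5 ℤ) (2 * h),
        complexBetti.map a (2 * h) c ∈ (⨆ i, (Submodule.span ℂ
            {x : complexBetti (X₁ ⊗ X₂) (2 * h) |
              IsRationalClass x ∧ IsOfHodgeType (h + h) (X₁ ⊗ X₂) (2 * h) h h x}).map
              (complexBetti.map (b i) (2 * h)).hom) →
        IsRationalClass c → IsOfHodgeType B.dim B.X (2 * h) h h c → c ∈ algebraicClasses B.X h :=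
  weilClassesCMField_cyclicPrymTwenty_zetaFive_of_weilClassesCMField (weilClassesCMField_of_hodgeConjecture hH)

end Twenty

/-! ### §4 `E = ℚ(ζ₁₆)`, `K′ = ℚ(ζ₈) = ℚ(s²)`: the `ζ₁₆`-primitive loci over `Xʰ₁₆ ⊗ Xʰ₁₆` -/

section Sixteen

/-- **R3 for `K′ = ℚ(ζ₈) ⊂ ℚ(ζ₁₆)` on the Fermat-pair-dominated `ζ₁₆`-locus, from the two named facts** (`B` with `s`,
`Φ₁₆(s) = 0`, `dim B = 4h`; datum over `Xʰ₁₆ ⊗ Xʰ₁₆`; classes of `weilClassesField B (s²) Φ₈ (2h)`). At `h = 2` the non-`E`-Weil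
`ℚ(ζ₈)`-Weil families are `β = (1,3,5,7)` (moving) and `(1,1,7,7)` (CM point) (report §3).
[cite: Shioda1979PJA, §2 Thm. 2 (p. 112) with the list after Thm. 1] [cite: Fulton1998, §19.2 Cor. 19.2 (b)]
[cite: MoonenZarhin1998WeilClasses, §1] -/
theorem weilClassesCMField_cyclicPrymSixteen_zetaEight_of_facts
    (hF₂ : hodgeClasses_algebraic_fermatProduct₂) (hP : fulton1998_map_mem_algebraicClasses) :
    ∀ (B : Motives.AbelianVariety ℂ) (s : B ⟶ B) (h : ℕ),
      Polynomial.eval₂ (Int.castRingHom (CategoryTheory.End B)) (s : CategoryTheory.End B)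
        (Polynomial.cyclotomic 16 ℤ) = 0 → B.dim = 4 * h →
    ∀ (X₁ X₂ T : Motives.SchemeOver ℂ),
      IsFermatVariety h 16 X₁ → IsSmoothProjective h X₁ → IsFermatVariety h 16 X₂ → IsSmoothProjective h X₂ →
      IsSmoothProjective B.dim T →
    ∀ (a : T ⟶ B.X), AlgebraicGeometry.Surjective a.left → ∀ (ι : Type) (b : ι → (T ⟶ X₁ ⊗ X₂)),
      ∀ c ∈ weilClassesField B (s ≫ s) (Polynomial.cyclotomic 8 ℤ) (2 * h),
        complexBetti.map a (2 * h) c ∈ (⨆ i, (Submodule.span ℂ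
            {x : complexBetti (X₁ ⊗ X₂) (2 * h) |
              IsRationalClass x ∧ IsOfHodgeType (h + h) (X₁ ⊗ X₂) (2 * h) h h x}).map
              (complexBetti.map (b i) (2 * h)).hom) →
        IsRationalClass c → IsOfHodgeType B.dim B.X (2 * h) h h c → c ∈ algebraicClasses B.X h := by
  intro B s h _ _ X₁ X₂ T hF₁' hX₁ hF₂' hX₂ hT a ha ι b c _ hc _ _
  exact abelianVariety_mem_algebraicClasses_of_targetTransferFamily hP B (hX₁.tensor_holds hX₂)
    (span_rational_hodge_le_algebraicClasses_fermatProduct₂ hF₂ (Or.inr ⟨by norm_num, by norm_num⟩) hF₁' hX₁ hF₂' hX₂ h)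
    hT a b hc

/-- **The same body from the rung R3 itself** (HONEST SPECIALISATION at `(A, φ, P, e, m) := (B, s², Φ₈, 4, h)`: every
arithmetic hypothesis discharged; `Φ₈(s²) = 0` from `Φ₁₆(s) = 0`). -/
theorem weilClassesCMField_cyclicPrymSixteen_zetaEight_of_weilClassesCMField (hR : WeilClassesCMField) :
    ∀ (B : Motives.AbelianVariety ℂ) (s : B ⟶ B) (h : ℕ),
      Polynomial.eval₂ (Int.castRingHom (CategoryTheory.End B)) (s : CategoryTheory.End B)
        (Polynomial.cyclotomic 16 ℤ) = 0 → B.dim = 4 * h →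
    ∀ (X₁ X₂ T : Motives.SchemeOver ℂ),
      IsFermatVariety h 16 X₁ → IsSmoothProjective h X₁ → IsFermatVariety h 16 X₂ → IsSmoothProjective h X₂ →
      IsSmoothProjective B.dim T →
    ∀ (a : T ⟶ B.X), AlgebraicGeometry.Surjective a.left → ∀ (ι : Type) (b : ι → (T ⟶ X₁ ⊗ X₂)),
      ∀ c ∈ weilClassesField B (s ≫ s) (Polynomial.cyclotomic 8 ℤ) (2 * h),
        complexBetti.map a (2 * h) c ∈ (⨆ i, (Submodule.span ℂ
            {x : complexBetti (X₁ ⊗ X₂) (2 * h) |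
              IsRationalClass x ∧ IsOfHodgeType (h + h) (X₁ ⊗ X₂) (2 * h) h h x}).map
              (complexBetti.map (b i) (2 * h)).hom) →
        IsRationalClass c → IsOfHodgeType B.dim B.X (2 * h) h h c → c ∈ algebraicClasses B.X h := by
  intro B s h hs hdim _ _ _ _ _ _ _ _ _ _ _ _ c hcW _ hc hmm
  obtain ⟨hmon, hdeg, hirr⟩ := cyclotomic_eight_monic_natDegree_irreducible
  have hφ : Polynomial.eval₂ (Int.castRingHom (CategoryTheory.End B))
      ((s ≫ s : B ⟶ B) : CategoryTheory.End B) (Polynomial.cyclotomic 8 ℤ) = 0 := by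
    have h2 := eval₂_cyclotomic_eight_pow_two (CategoryTheory.End.of s) hs
    rwa [← end_of_comp_two] at h2
  exact hR B (s ≫ s) (Polynomial.cyclotomic 8 ℤ) 4 h hmon hdeg (by norm_num) hirr hφ (by omega)
    (fun ρ hρ => conj_ne_self_of_eval₂_cyclotomic (by norm_num) hρ)
    (exists_conjPolynomial_of_cyclotomic (by norm_num)) c hcW hc hmm

/-- **On-path lemma**: `HodgeConjecture → WeilClassesCMField →` R3 for `ℚ(ζ₈) ⊂ ℚ(ζ₁₆)` on the `ζ₁₆`-locus. -/
theorem weilClassesCMField_cyclicPrymSixteen_zetaEight_of_hodgeConjecture (hH : _root_.HodgeConjecture) :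
    ∀ (B : Motives.AbelianVariety ℂ) (s : B ⟶ B) (h : ℕ),
      Polynomial.eval₂ (Int.castRingHom (CategoryTheory.End B)) (s : CategoryTheory.End B)
        (Polynomial.cyclotomic 16 ℤ) = 0 → B.dim = 4 * h →
    ∀ (X₁ X₂ T : Motives.SchemeOver ℂ),
      IsFermatVariety h 16 X₁ → IsSmoothProjective h X₁ → IsFermatVariety h 16 X₂ → IsSmoothProjective h X₂ →
      IsSmoothProjective B.dim T →
    ∀ (a : T ⟶ B.X), AlgebraicGeometry.Surjective a.left → ∀ (ι : Type) (b : ι → (T ⟶ X₁ ⊗ X₂)),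
      ∀ c ∈ weilClassesField B (s ≫ s) (Polynomial.cyclotomic 8 ℤ) (2 * h),
        complexBetti.map a (2 * h) c ∈ (⨆ i, (Submodule.span ℂ
            {x : complexBetti (X₁ ⊗ X₂) (2 * h) |
              IsRationalClass x ∧ IsOfHodgeType (h + h) (X₁ ⊗ X₂) (2 * h) h h x}).map
              (complexBetti.map (b i) (2 * h)).hom) →
        IsRationalClass c → IsOfHodgeType B.dim B.X (2 * h) h h c → c ∈ algebraicClasses B.X h :=
  weilClassesCMField_cyclicPrymSixteen_zetaEight_of_weilClassesCMField (weilClassesCMField_of_hodgeConjecture hH)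

end Sixteen

end Summit.HodgeConjecture.HodgeConjecture.WeilTypeLadder

end
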